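/-
COR-CM (cell pub-hodgecm2, stage 2 of the Hodge ladder): the E term with the binder `h₃` INSTANTIATED from Riemann's
theorem.  Seat prover-pub-hodgecm2-b18 (gen 11), 2026-08-20.  Count-neutral (no BINDER-OWNERS row).
-/
import Summits.HodgeConjecture.CorCM.Assembly.ModelChain
import Literature.AlgebraicGeometry.ComplexMultiplication.CMAbelianVarietyRealisedOfRiemann
import HarnessLib

/-!
# The stage-2 E term on the model built from Riemann's theorem: leaves `h₁`, `hR`, `hE` only

The E term of record `hc_cm_of_PerLFace : HC_CM_of_PerLFace` (`Assembly/ModelChain.lean`, p238778) reads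
`∀ hHD hI h₁ h₃, (Model.picardCMUniverse hHD hI h₁ h₃).PerLFace → DeligneMilne1982_Thm_6_20_full → HC_CM`,
with displayed leaves `hHD`, `hI` (both PROVED in the tree: `exists_isReal_hodgeModel_holds`,
`hodgePQ_independent_of_hodgeModel_holds`), `h₁ : BallQuotientUniformised`, `h₃ : CMAbelianVarietyRealised`
and `hR` (binder B02).  By `ComplexMultiplication.cmAbelianVarietyRealised_of_riemann` (Literature, this seat)
`h₃` is a THEOREM modulo the two clauses of Riemann's theorem (Deligne–Milne 1982 Thm. 6.20): fullness `hR`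
(already a leaf) and essential image `hE : DeligneMilne1982_Thm_6_20_essImage`.  This file records the
resulting closed arrow: on the model universe of record built with `hHD, hI` discharged and
`h₃ := cmAbelianVarietyRealised_of_riemann hR hE`, the face-form period theorem implies `HC_CM`
(`= Summit.HodgeConjecture.HodgeConjecture.Theses.RankFourFaces.CMAbelianHodge` by name) — leaves
`h₁`, `hR`, `hE`, `PerLFace`.

References: [Shimura1998] §6.2 Thm. 3; [DeligneMilne1982Tannakian] §6 Thm. 6.20.
-/

noncomputable section

namespace Summit.HodgeConjecture.CorCM

open Literature.AlgebraicGeometry.HodgeTheory Literature.AlgebraicGeometry.ComplexMultiplication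
open Literature.NumberTheory.Automorphic Literature.NumberTheory.Automorphic.PicardCM

/-- **HC_CM from the face-form period theorem on the Riemann-built model — leaves `h₁`, `hR`, `hE` only.**
The E term of record `hc_cm_of_PerLFace` at `hHD := exists_isReal_hodgeModel_holds`,
`hI := hodgePQ_independent_of_hodgeModel_holds`, `h₃ := cmAbelianVarietyRealised_of_riemann hR hE`. -/
theorem hc_cm_of_PerLFace_of_riemann (h₁ : BallQuotientUniformised) (hR : DeligneMilne1982_Thm_6_20_full)
    (hE : DeligneMilne1982_Thm_6_20_essImage)
    (hP : (Model.picardCMUniverse exists_isReal_hodgeModel_holds hodgePQ_independent_of_hodgeModel_holds h₁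
      (cmAbelianVarietyRealised_of_riemann hR hE)).PerLFace) :
    HC_CM :=
  hc_cm_of_PerLFace _ _ h₁ _ hP hR

/-- The same, with the literal stage-1 hypothesis `PerL` modulo binder B01 (`PerLFace_of_PerL`, gap G-T):
leaves `h₁`, `hR`, `hE`, B01, `PerL`. -/
theorem hc_cm_of_PerL_of_B01_of_riemann (hB01 : PerLFace_of_PerL) (h₁ : BallQuotientUniformised)
    (hR : DeligneMilne1982_Thm_6_20_full) (hE : DeligneMilne1982_Thm_6_20_essImage)
    (hP : (Model.picardCMUniverse exists_isReal_hodgeModel_holds hodgePQ_independent_of_hodgeModel_holds h₁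
      (cmAbelianVarietyRealised_of_riemann hR hE)).PerL) :
    HC_CM :=
  hc_cm_of_PerL_of_B01 hB01 _ _ h₁ _ hP hR

end Summit.HodgeConjecture.CorCM

end
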